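import Summits.AtomisticToContinuum.BoseEinsteinCondensation.Theses.BECMeanFieldControl

/-!
# AtomisticToContinuum / BoseEinsteinCondensation — route `BECMeanFieldControl`, assembly

Settles the assembly item `stmt-AtomisticToContinuum-11280` of route
`route-AtomisticToContinuum-BECMeanFieldControl`: the implication
`TypicalLandscape → PeriodicRigidity → LandscapeToCondensate → PeriodicOccupationStability →
BoundaryTransferWeak → BoseEinsteinCondensation`.

The hypotheses of `Assembly` are, verbatim and in the same order, those of the route's deciding
theorem `closes`, so the assembly is that theorem curried. For the record, the composition is:
fix an admissible `v`; take `ρ₀` the minimum of the thresholds of `TypicalLandscape` and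
`PeriodicRigidity`; for `ρ < ρ₀` get the landscape constant `C`; eventually in `N = n + 1`,
`PeriodicRigidity` at tolerance `η = e^{-C}/8` fixes `δ`, `TypicalLandscape` at this `δ` gives a
nonnegative periodic `δ`-near-minimiser `Ψ` with exceptional mass `≤ L³/2`, so
`LandscapeToCondensate` gives `occ₀(Ψ) ≥ (n+1)e^{-C}/2`; for any `δ`-near-minimiser `Φ` rigidity
gives `‖Ψ − cΦ‖² ≤ η` and `PeriodicOccupationStability` gives `occ₀(Φ) ≥ e^{-C}(n+1)/32` — the
periodic-BEC body for `v`, which `BoundaryTransferWeak v` turns into the Dirichlet conjunct.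
Pure logic here; the bookkeeping lives in `closes`.
-/

namespace Summit.AtomisticToContinuum.BoseEinsteinCondensation.Theorems

/-- Settles `stmt-AtomisticToContinuum-11280` (exact signature): the assembly of route
`BECMeanFieldControl`, i.e. its five items `TypicalLandscape`, `PeriodicRigidity`,
`LandscapeToCondensate`, `PeriodicOccupationStability`, `BoundaryTransferWeak` imply the sub-problem
statement `BoseEinsteinCondensation`. Proof: the route's deciding theorem `closes`, curried.
[folklore] -/
theorem becMeanFieldControl_assembly_proof :
    Summit.AtomisticToContinuum.BoseEinsteinCondensation.Theses.BECMeanFieldControl.Assembly := by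
  unfold Theses.BECMeanFieldControl.Assembly
  intro h₁ h₂ h₃ h₄ h₅
  exact Theses.BECMeanFieldControl.closes h₁ h₂ h₃ h₄ h₅

end Summit.AtomisticToContinuum.BoseEinsteinCondensation.Theorems
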